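import Summits.QuantumFields.BalabanUV.Beta.GAN24.CombLegChainGauge
import Summits.QuantumFields.BalabanUV.Beta.GAN24.ContactKernelCells

/-!
# The conjugated (comb-chart) dressed leg chains, KERNEL ENTRY BY KERNEL ENTRY, are the undressed one-shot response plus ONE pure gauge;
# the (III′) contact term of the cubic Wilson push is three explicit one-gauge cells

NOT IN PRINT — OUR BOOKKEEPING (road-P2 = `b2b-balaban-gan24-p2` gen 56, 2026-08-25; row G-an2-4 ∕ (CONV-C), the (α-0) chain at row D1's literal
OF RECORD (III′) `JsB12CombShSym`; [folklore] composition BY NAME; 0 `def`, 0 cite, 0 `def … : Prop`, 0 `sorry`).  Weight 0.  NEVER «G-an2-4 closed» as (CONV-C);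
NOT D1, NOT BetaPertH, NOT continuum, NOT Clay; NO campaign opened (an2 W-4).

This is the (III′) twin of leaf-01 g58's (E) `GAN24/ContactKernelCells` §1 + §3 over the OWNER gan24-p1 g47's leg dictionary, first word,
`GAN24/CombLegChainGauge.legAct_legChain_psiLeg_eq` (THE DECOMPOSITION `legAct (legChain (j ↦ legComp ψ♭ R_j) m k) b = legAct (legChain R m k) b + dz (PsiFace r ρ Lc m k b)`,
`R_j = respStepBmSeq ρ Lc j`, `ψ♭ α x κ u = Ψ̂_S u x (inl κ) (inl α)`, `Ψ̂_S = psiKS r Lc`), read at the point datum `delta1 μ z` (leaf-01's `DressedLegEnvelope.legAct_delta1`):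
* §1 (generic `d`, roots `r, rr ∈ box`) **THE CONJUGATED COMPOSITE LEG, KERNEL FORM**: `combLegChain_apply_eq_add_dz` —
  `legChain (j ↦ legComp ψ♭ R_j) m k μ z κ u = respStep (Lc^m) (Lc^(m+k+1)) μ z κ u + dz (λ′ μ z) κ u` with the GAUGE FUNCTION OF THE BOND
  `λ′ μ z := Psi ρ Lc m k (delta1 μ z) + PsiFace r ρ Lc m k (delta1 μ z) − bmGaugeAt ρ (respStep (Lc^m) (Lc^(m+k+1)) μ z) Lc` (the (E) gauge function of
  `ContactKernelCells.legChain_respStepBmSeq_apply_eq_add_dz` PLUS the face term); `combLegChain_sub_respStep` (the difference family conjugated − undressed is the pure-gauge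
  family `(μ, z, κ, u) ↦ dz (λ′ μ z) κ u`), `combLegChain_sub_legChain` (conjugated − dressed = `dz (PsiFace … (delta1 μ z))`, the kernel form of the OWNER's decomposition),
  `combLegChain_sub_respStep_of_lt` (the same for the lineage born at level `i < k`, legs `legChain _ i (k−1−i)` against `respStep (Lc^i) (Lc^k)`).
* §2 (`d = 3`, ANY `Lc ≥ 1`, roots in the box, every `m k`; NO other hypothesis) **CT-3c AT (III′), KERNEL HALF — THE CONTACT TERM OF THE CONJUGATED CUBIC WILSON PUSH IS THREE
  EXPLICIT ONE-GAUGE CELLS**: `contact_combLegChain_ff_eq_cells` — leaf-01's `contact_ff_eq_cells` with the conjugated legs `T′ = legChain (j ↦ legComp ψ♭ R_j) m k` in all three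
  dressed slots, `B = respStep (Lc^m) (Lc^(m+k+1))` in the undressed slots and the gauge functions `λ′`; the summable class of `T′` is the OWNER's `exists_legL1_legChain_psiLeg`
  (`LegL1` ⇒ bounded with summable fine slices — no envelope needed, hence no `2 ≤ Lc`), that of `B` is leaf-12's (N1) `exists_respStep_decay_and_grad` as at (E).
What is LEFT of the (III′) contact END after this module is the analysis of the three cells with ONE new ingredient against (E): the face term `PsiFace` inside `λ′`
(the OWNER's NEXT words `CombLegFaceSawtoothBlockL1` ∕ `CombLegBlockL1Envelope`, MEMO M-gan24p1-g47-1 §2).  Discharges NOTHING; NO estimate; NO value of Bałaban's tables.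
-/

noncomputable section

open Finset
open scoped BigOperators
open Literature.MathematicalPhysics.QuantumFieldTheory
open Literature.MathematicalPhysics.QuantumFieldTheory.LatticeForm (quo)
open Literature.MathematicalPhysics.QuantumFieldTheory.Balaban1983to89
open Literature.MathematicalPhysics.QuantumFieldTheory.Balaban1983to89.Beta
open B4ContourShift (supNorm)
open StepJetData (wilsonA)
open AffineAveraging (Form1 Site box toSite dz curv curvAdj)
open AffineReproduction (dz_sub dz_add)
open B6BondElimination (unitVec)
open KKTFluctuationKernel (delta1)
open BalabanCompositeJets (respStep)
open Summit.QuantumFields.BalabanUV.Beta.AxialProjectorBlockMean (bmGaugeAt)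
open Summit.QuantumFields.BalabanUV.Beta.SymCorrectorKernel (psiKS)
open Summit.QuantumFields.BalabanUV.Beta.GAN24.Push4 (legComp)
open Summit.QuantumFields.BalabanUV.Beta.GAN24.Push4Iter (legChain)
open Summit.QuantumFields.BalabanUV.Beta.GAN24.Push3 (push₃)
open Summit.QuantumFields.BalabanUV.Beta.GAN24.RespStepBmDecompLegs (legAct LegL1)
open Summit.QuantumFields.BalabanUV.Beta.GAN24.RespStepBmDecompExact (respStepBmSeq)
open Summit.QuantumFields.BalabanUV.Beta.GAN24.RespStepBmDecompPsi (Psi)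
open Summit.QuantumFields.BalabanUV.Beta.GAN24.RespStepDecay (exists_respStep_decay_and_grad)
open Summit.QuantumFields.BalabanUV.Beta.GAN24.UndressedResponseUnits (inv_cast_pow_pow)
open Summit.QuantumFields.BalabanUV.Beta.GAN24.DressedLegEnvelope (legAct_delta1)
open Summit.QuantumFields.BalabanUV.Beta.GAN24.Push3LegTelescope (abs_le_of_env' summable_of_env')
open Summit.QuantumFields.BalabanUV.Beta.GAN24.ContactKernelCells (summable_delta1 legAct_delta1_eq legChain_respStepBmSeq_apply_eq_add_dz contact_ff_eq_cells)
open Summit.QuantumFields.BalabanUV.Beta.GAN24.CombLegChainGauge (PsiFace legAct_legChain_psiLeg_eq exists_legL1_legChain_psiLeg)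

namespace Summit.QuantumFields.BalabanUV.Beta.GAN24.CombContactKernelCells

variable {d : ℕ} {Lc : ℕ} [NeZero Lc]

/-! ## §1 The conjugated composite leg, kernel entry by kernel entry, is the undressed one-shot response plus a pure gauge (generic `d`) -/

section Gauge

variable {r : Fin (d + 1) → ℕ} (hr : r ∈ box (d + 1) Lc) {rr : Fin (d + 1) → ℕ} (hrr : rr ∈ box (d + 1) Lc)
include hr hrr

/-- NOT IN PRINT; OUR BOOKKEEPING ([folklore]: the OWNER's decomposition `legAct_legChain_psiLeg_eq` and leaf-01's (E) kernel form, both read at the point datum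
`delta1 μ z`).  **THE CONJUGATED COMPOSITE LEG, KERNEL ENTRY BY KERNEL ENTRY, IS THE UNDRESSED ONE-SHOT RESPONSE PLUS A PURE GAUGE**: for every source bond `(μ, z)`
and output bond `(κ, u)`, `legChain (j ↦ legComp ψ♭ R_j) m k μ z κ u = respStep (Lc^m) (Lc^(m+k+1)) μ z κ u + dz (λ′ μ z) κ u` with
`λ′ μ z := Psi ρ Lc m k (delta1 μ z) + PsiFace r ρ Lc m k (delta1 μ z) − bmGaugeAt ρ (respStep (Lc^m) (Lc^(m+k+1)) μ z) Lc`, `ρ = toSite rr`. -/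
theorem combLegChain_apply_eq_add_dz (m k : ℕ) (μ : Fin (d + 1)) (z : Site (d + 1)) (κ : Fin (d + 1)) (u : Site (d + 1)) :
    legChain (fun j => legComp (fun α x κ u => psiKS r Lc u x (Sum.inl κ) (Sum.inl α)) (respStepBmSeq (d := d) (toSite rr) Lc j)) m k μ z κ u
      = respStep (d := d) (Lc ^ m) (Lc ^ (m + k + 1)) μ z κ u
        + dz (Psi (toSite rr) Lc m k (delta1 μ z) + PsiFace r (toSite rr) Lc m k (delta1 μ z)
            - bmGaugeAt (toSite rr) (respStep (d := d) (Lc ^ m) (Lc ^ (m + k + 1)) μ z) Lc) κ u := by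
  rw [← legAct_delta1 (legChain (fun j => legComp (fun α x κ u => psiKS r Lc u x (Sum.inl κ) (Sum.inl α)) (respStepBmSeq (d := d) (toSite rr) Lc j)) m k) μ z κ u,
    legAct_legChain_psiLeg_eq hr hrr k m (summable_delta1 μ z), Pi.add_apply, Pi.add_apply, legAct_delta1_eq,
    legChain_respStepBmSeq_apply_eq_add_dz hrr, dz_sub, dz_sub, dz_add]
  simp only [Pi.add_apply, Pi.sub_apply]
  ring

/-- NOT IN PRINT; OUR BOOKKEEPING ([folklore]).  **THE DIFFERENCE FAMILY CONJUGATED − UNDRESSED IS ONE PURE-GAUGE FAMILY**: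
`legChain (j ↦ legComp ψ♭ R_j) m k − respStep (Lc^m) (Lc^(m+k+1)) = (μ, z, κ, u) ↦ dz (λ′ μ z) κ u`, `λ′` as above — the hypotheses `hL = hR = hW` of leaf-01's
`ContactKernelCells.contact_ff_eq_cells` (and of leaf-02's `contact_lambda_eq_cells`) for the (III′) legs. -/
theorem combLegChain_sub_respStep (m k : ℕ) :
    legChain (fun j => legComp (fun α x κ u => psiKS r Lc u x (Sum.inl κ) (Sum.inl α)) (respStepBmSeq (d := d) (toSite rr) Lc j)) m k
        - respStep (d := d) (Lc ^ m) (Lc ^ (m + k + 1))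
      = fun μ z κ u => dz (Psi (toSite rr) Lc m k (delta1 μ z) + PsiFace r (toSite rr) Lc m k (delta1 μ z)
          - bmGaugeAt (toSite rr) (respStep (d := d) (Lc ^ m) (Lc ^ (m + k + 1)) μ z) Lc) κ u := by
  funext μ z κ u
  rw [Pi.sub_apply, Pi.sub_apply, Pi.sub_apply, Pi.sub_apply, combLegChain_apply_eq_add_dz hr hrr, add_sub_cancel_left]

/-- NOT IN PRINT; OUR BOOKKEEPING ([folklore]).  **THE KERNEL FORM OF THE OWNER'S DECOMPOSITION**: conjugated − dressed is the inter-block face gauge,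
`legChain (j ↦ legComp ψ♭ R_j) m k − legChain R m k = (μ, z, κ, u) ↦ dz (PsiFace r ρ Lc m k (delta1 μ z)) κ u`. -/
theorem combLegChain_sub_legChain (m k : ℕ) :
    legChain (fun j => legComp (fun α x κ u => psiKS r Lc u x (Sum.inl κ) (Sum.inl α)) (respStepBmSeq (d := d) (toSite rr) Lc j)) m k
        - legChain (respStepBmSeq (d := d) (toSite rr) Lc) m k
      = fun μ z κ u => dz (PsiFace r (toSite rr) Lc m k (delta1 μ z)) κ u := by
  funext μ z κ u
  rw [Pi.sub_apply, Pi.sub_apply, Pi.sub_apply, Pi.sub_apply,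
    ← legAct_delta1 (legChain (fun j => legComp (fun α x κ u => psiKS r Lc u x (Sum.inl κ) (Sum.inl α)) (respStepBmSeq (d := d) (toSite rr) Lc j)) m k) μ z κ u,
    legAct_legChain_psiLeg_eq hr hrr k m (summable_delta1 μ z), Pi.add_apply, Pi.add_apply, legAct_delta1_eq, add_sub_cancel_left]

/-- NOT IN PRINT; OUR BOOKKEEPING ([folklore]; the (III′) twin of leaf-01 g59's `BornLambdaLineage.legChain_sub_respStep_of_lt`).  **THE LEG DIFFERENCE OF THE
LINEAGE BORN AT LEVEL `i < k` IS ONE PURE-GAUGE FAMILY**: `T′_i − B_i = (μ, z, κ, u) ↦ dz (λ′_i μ z) κ u` with `T′_i = legChain (j ↦ legComp ψ♭ R_j) i (k−1−i)`,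
`B_i = respStep (Lc^i) (Lc^k)` and `λ′_i μ z = Psi ρ Lc i (k−1−i) (delta1 μ z) + PsiFace r ρ Lc i (k−1−i) (delta1 μ z) − bmGaugeAt ρ (B_i μ z) Lc`. -/
theorem combLegChain_sub_respStep_of_lt {i k : ℕ} (hik : i < k) :
    legChain (fun j => legComp (fun α x κ u => psiKS r Lc u x (Sum.inl κ) (Sum.inl α)) (respStepBmSeq (d := d) (toSite rr) Lc j)) i (k - 1 - i)
        - respStep (d := d) (Lc ^ i) (Lc ^ k)
      = fun μ z κ u => dz (Psi (toSite rr) Lc i (k - 1 - i) (delta1 μ z) + PsiFace r (toSite rr) Lc i (k - 1 - i) (delta1 μ z)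
          - bmGaugeAt (toSite rr) (respStep (d := d) (Lc ^ i) (Lc ^ k) μ z) Lc) κ u := by
  have hk : i + (k - 1 - i) + 1 = k := by omega
  have h := combLegChain_sub_respStep hr hrr i (k - 1 - i)
  rw [hk] at h
  exact h

end Gauge

/-! ## §2 `d = 3`: the (III′) contact term of the cubic Wilson push is three explicit one-gauge cells, unconditionally -/

section Four

variable {Lc : ℕ} [NeZero Lc]

/-- NOT IN PRINT; OUR BOOKKEEPING ([folklore]; the (III′) twin of leaf-01 g58's `contact_legChain_ff_eq_cells`).  **CT-3c AT THE COMB CHART, KERNEL HALF — THE CONTACT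
TERM OF THE CONJUGATED CUBIC WILSON PUSH IS THREE EXPLICIT ONE-GAUGE CELLS** (`d = 3`, ANY `Lc ≥ 1`, roots `r, rr ∈ box`, every `m k`; NO other hypothesis): with the
conjugated composite legs `T′ := legChain (j ↦ legComp ψ♭ R_j) m k` in all three slots, the undressed one-shot legs `B := respStep (Lc^m) (Lc^(m+k+1))` in all three slots,
and the bond gauge functions `λ′ μ z := Psi ρ Lc m k (delta1 μ z) + PsiFace r ρ Lc m k (delta1 μ z) − bmGaugeAt ρ (B μ z) Lc` (§1), every field entry of
`push₃ T′ T′ T′ (wilsonA 3) κ′ u′ − push₃ B B B (wilsonA 3) κ′ u′` equals `[LEFT cell: T₃ = T′ β z′, T₁ = T′ κ′ u′, ψ = λ′ α x′] − [RIGHT cell: T₃ = B α x′, T₁ = T′ κ′ u′,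
ψ = λ′ β z′] + [TABLE cell: TR = B β z′, TL = B α x′, ψ = λ′ κ′ u′]` in leaf-02's `cell_eq'` ∕ `cellIdx_eq'` nesting.  Summable class: `T′` by the OWNER's
`exists_legL1_legChain_psiLeg`, `B` by leaf-12's (N1).  What remains of the (III′) contact END is the analysis of the three cells; against (E) the ONE new ingredient is
the face term `PsiFace` in `λ′`. -/
theorem contact_combLegChain_ff_eq_cells {r : Fin (3 + 1) → ℕ} (hr : r ∈ box (3 + 1) Lc) {rr : Fin (3 + 1) → ℕ} (hrr : rr ∈ box (3 + 1) Lc) (m k : ℕ)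
    (κ' : Fin (3 + 1)) (u' x' z' : Site (3 + 1)) (α β : Fin (3 + 1)) :
    push₃ (legChain (fun j => legComp (fun α x κ u => psiKS r Lc u x (Sum.inl κ) (Sum.inl α)) (respStepBmSeq (d := 3) (toSite rr) Lc j)) m k)
        (legChain (fun j => legComp (fun α x κ u => psiKS r Lc u x (Sum.inl κ) (Sum.inl α)) (respStepBmSeq (d := 3) (toSite rr) Lc j)) m k)
        (legChain (fun j => legComp (fun α x κ u => psiKS r Lc u x (Sum.inl κ) (Sum.inl α)) (respStepBmSeq (d := 3) (toSite rr) Lc j)) m k)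
        (wilsonA 3) κ' u' x' z' (Sum.inl α) (Sum.inl β)
      - push₃ (respStep (d := 3) (Lc ^ m) (Lc ^ (m + k + 1))) (respStep (d := 3) (Lc ^ m) (Lc ^ (m + k + 1)))
        (respStep (d := 3) (Lc ^ m) (Lc ^ (m + k + 1))) (wilsonA 3) κ' u' x' z' (Sum.inl α) (Sum.inl β)
      = (∑' z, ∑ b, legChain (fun j => legComp (fun α x κ u => psiKS r Lc u x (Sum.inl κ) (Sum.inl α)) (respStepBmSeq (d := 3) (toSite rr) Lc j)) m k β z' b z *
            ∑' u, ∑ κ, legChain (fun j => legComp (fun α x κ u => psiKS r Lc u x (Sum.inl κ) (Sum.inl α)) (respStepBmSeq (d := 3) (toSite rr) Lc j)) m k κ' u' κ u *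
              ((1 / 2 : ℝ) *
                ((Psi (toSite rr) Lc m k (delta1 α x') + PsiFace r (toSite rr) Lc m k (delta1 α x')
                    - bmGaugeAt (toSite rr) (respStep (d := 3) (Lc ^ m) (Lc ^ (m + k + 1)) α x') Lc) (u + unitVec κ)
                  - ((Psi (toSite rr) Lc m k (delta1 α x') + PsiFace r (toSite rr) Lc m k (delta1 α x')
                        - bmGaugeAt (toSite rr) (respStep (d := 3) (Lc ^ m) (Lc ^ (m + k + 1)) α x') Lc) z
                    + (Psi (toSite rr) Lc m k (delta1 α x') + PsiFace r (toSite rr) Lc m k (delta1 α x')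
                        - bmGaugeAt (toSite rr) (respStep (d := 3) (Lc ^ m) (Lc ^ (m + k + 1)) α x') Lc) (z + unitVec b)) / 2) *
                curvAdj (curv (delta1 κ u)) b z))
        - (∑' x, ∑ a, respStep (d := 3) (Lc ^ m) (Lc ^ (m + k + 1)) α x' a x *
            ∑' u, ∑ κ, legChain (fun j => legComp (fun α x κ u => psiKS r Lc u x (Sum.inl κ) (Sum.inl α)) (respStepBmSeq (d := 3) (toSite rr) Lc j)) m k κ' u' κ u *
              ((1 / 2 : ℝ) *
                ((Psi (toSite rr) Lc m k (delta1 β z') + PsiFace r (toSite rr) Lc m k (delta1 β z')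
                    - bmGaugeAt (toSite rr) (respStep (d := 3) (Lc ^ m) (Lc ^ (m + k + 1)) β z') Lc) (u + unitVec κ)
                  - ((Psi (toSite rr) Lc m k (delta1 β z') + PsiFace r (toSite rr) Lc m k (delta1 β z')
                        - bmGaugeAt (toSite rr) (respStep (d := 3) (Lc ^ m) (Lc ^ (m + k + 1)) β z') Lc) x
                    + (Psi (toSite rr) Lc m k (delta1 β z') + PsiFace r (toSite rr) Lc m k (delta1 β z')
                        - bmGaugeAt (toSite rr) (respStep (d := 3) (Lc ^ m) (Lc ^ (m + k + 1)) β z') Lc) (x + unitVec a)) / 2) *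
                curvAdj (curv (delta1 κ u)) a x))
        + (∑' z, ∑ b, respStep (d := 3) (Lc ^ m) (Lc ^ (m + k + 1)) β z' b z *
            ∑' x, ∑ a, respStep (d := 3) (Lc ^ m) (Lc ^ (m + k + 1)) α x' a x *
              ((1 / 2 : ℝ) *
                ((Psi (toSite rr) Lc m k (delta1 κ' u') + PsiFace r (toSite rr) Lc m k (delta1 κ' u')
                    - bmGaugeAt (toSite rr) (respStep (d := 3) (Lc ^ m) (Lc ^ (m + k + 1)) κ' u') Lc) z
                  - (Psi (toSite rr) Lc m k (delta1 κ' u') + PsiFace r (toSite rr) Lc m k (delta1 κ' u')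
                    - bmGaugeAt (toSite rr) (respStep (d := 3) (Lc ^ m) (Lc ^ (m + k + 1)) κ' u') Lc) x) *
                curvAdj (curv (delta1 b z)) a x)) := by
  -- the summable class: conjugated legs by the OWNER's `LegL1` lemma, undressed legs by leaf-12's (N1)
  have hL1 : 1 ≤ Lc ^ (k + 1) := Nat.one_le_pow _ _ (Nat.pos_of_ne_zero (NeZero.ne Lc))
  obtain ⟨CT, TT, hT⟩ := exists_legL1_legChain_psiLeg (d := 3) hr hrr m k
  obtain ⟨κB, C, -, hκB, -, -, hN1, -⟩ := exists_respStep_decay_and_grad (Lc := Lc)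
  have hBnv : ∀ μ y κ u, |respStep (d := 3) (Lc ^ m) (Lc ^ (m + k + 1)) μ y κ u|
      ≤ C * ((Lc : ℝ) ^ ((3 + 2) * (k + 1)))⁻¹ * Real.exp (-(κB * supNorm (quo (Lc ^ (k + 1)) u - y))) := by
    intro μ y κ u
    have h := hN1 m k μ y κ u
    rwa [inv_cast_pow_pow] at h
  have hTa : ∀ μ y κ u, |legChain (fun j => legComp (fun α x κ u => psiKS r Lc u x (Sum.inl κ) (Sum.inl α)) (respStepBmSeq (d := 3) (toSite rr) Lc j)) m k μ y κ u| ≤ CT :=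
    fun μ y κ u => hT.abs_le μ y κ u
  have hTs : ∀ μ y κ, Summable fun u => legChain (fun j => legComp (fun α x κ u => psiKS r Lc u x (Sum.inl κ) (Sum.inl α)) (respStepBmSeq (d := 3) (toSite rr) Lc j)) m k μ y κ u :=
    fun μ y κ => (hT.2 μ y κ).1
  exact contact_ff_eq_cells hTa hTs (abs_le_of_env' hκB.le hBnv) (summable_of_env' hL1 hκB hBnv) hTa hTs (abs_le_of_env' hκB.le hBnv)
    (summable_of_env' hL1 hκB hBnv) hTa (abs_le_of_env' hκB.le hBnv)
    (combLegChain_sub_respStep hr hrr m k) (combLegChain_sub_respStep hr hrr m k) (combLegChain_sub_respStep hr hrr m k) κ' u' x' z' α β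

end Four

end Summit.QuantumFields.BalabanUV.Beta.GAN24.CombContactKernelCells

end
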